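import Summits.AtomisticToContinuum.FouriersLaw.Theses.OddSectorIrreversibility
import Summits.AtomisticToContinuum.FouriersLaw.Theorems.OddSectorIrreversibilityCorrectorTheoryDetFlow
import Literature.MathematicalPhysics.KineticTheory.LangevinChainHormander

/-!
# `TapLeakBound` / Negative (2a): explicit Liouville algebra of the quartic 3-chain

Support for the negative lemma `FalseWithoutCorrector` of crux `stmt-AtomisticToContinuum-15159`
(`OddSectorIrreversibility.TapLeakBound`, "P"): for the pinned chain `(ω₂, lam, β) = (1,1,1)` with
`N = 3` sites, the middle bond current `j_1 = −½(p_1+p_2)V′(q_2−q_1)` and the closed forms of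
`A j_1` and `A² j_1` (`A = X_H` the Liouville operator), obtained by kernel-checked coordinate calculus
(`partialQ`/`partialP` of explicit polynomials: `Function.update` bookkeeping on `Fin 3`, then `simp`
with the `deriv` rules discharged by `fun_prop`, then `ring`). Also a generic third-order sign lemma
on `ℝ` (`exists_ne_zero_of_deriv3_ne_zero`). No Theses statement is mentioned. All [folklore].
-/

noncomputable section
open scoped ContDiff
open Literature.MathematicalPhysics.KineticTheory.HeatConduction
open Literature.MathematicalPhysics.KineticTheory
open Summit.AtomisticToContinuum.FouriersLaw.Theorems.SuperadditiveResistance.DeviceLiouville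

namespace Summit.AtomisticToContinuum.FouriersLaw.Theorems.TapLeakBound.Negative.LiouvilleAlgebraN3

section upd
variable {α : Type*} (f : Fin 3 → α) (t : α)
/-- `upd01` (explicit computation / helper for the third-order witness). [folklore] -/
@[simp] theorem upd01 : Function.update f 0 t 1 = f 1 := Function.update_of_ne (by decide) _ _
/-- `upd02` (explicit computation / helper for the third-order witness). [folklore] -/
@[simp] theorem upd02 : Function.update f 0 t 2 = f 2 := Function.update_of_ne (by decide) _ _
/-- `upd10` (explicit computation / helper for the third-order witness). [folklore] -/
@[simp] theorem upd10 : Function.update f 1 t 0 = f 0 := Function.update_of_ne (by decide) _ _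
/-- `upd12` (explicit computation / helper for the third-order witness). [folklore] -/
@[simp] theorem upd12 : Function.update f 1 t 2 = f 2 := Function.update_of_ne (by decide) _ _
/-- `upd20` (explicit computation / helper for the third-order witness). [folklore] -/
@[simp] theorem upd20 : Function.update f 2 t 0 = f 0 := Function.update_of_ne (by decide) _ _
/-- `upd21` (explicit computation / helper for the third-order witness). [folklore] -/
@[simp] theorem upd21 : Function.update f 2 t 1 = f 1 := Function.update_of_ne (by decide) _ _
end upd

/-- `deriv_const_sub_self` (explicit computation / helper for the third-order witness). [folklore] -/
theorem deriv_const_sub_self (c x : ℝ) : deriv (fun t => c - t) x = -1 := by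
  rw [deriv_const_sub, deriv_id'']
/-- `deriv_const_sub_self'` (explicit computation / helper for the third-order witness). [folklore] -/
theorem deriv_const_sub_self' (c x : ℝ) : deriv (HSub.hSub c) x = -1 := deriv_const_sub_self c x
/-- `deriv_const_add_self` (explicit computation / helper for the third-order witness). [folklore] -/
theorem deriv_const_add_self (c x : ℝ) : deriv (fun t => c + t) x = 1 := by
  rw [deriv_const_add, deriv_id'']
/-- `deriv_const_add_self'` (explicit computation / helper for the third-order witness). [folklore] -/
theorem deriv_const_add_self' (c x : ℝ) : deriv (HAdd.hAdd c) x = 1 := deriv_const_add_self c x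
/-- `deriv_const_mul_self'` (explicit computation / helper for the third-order witness). [folklore] -/
theorem deriv_const_mul_self' (c x : ℝ) : deriv (HMul.hMul c) x = c := deriv_const_mul_id c


/-- the pinned anharmonic 3-chain with ω₂ = lam = β = 1 [folklore] -/
abbrev P3 (γ : ℝ) : OscillatorChain := pinnedChain 1 1 1 γ

/-- explicit middle-bond current j_1 [folklore] -/
def j1 (x : PhaseSpace 3) : ℝ :=
  -((x.2 1 + x.2 2) / 2 * ((x.1 2 - x.1 1) + (x.1 2 - x.1 1) ^ 3))

/-- `bondCurrent_one_eq` (explicit computation / helper for the third-order witness). [folklore] -/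
theorem bondCurrent_one_eq (γ : ℝ) : (P3 γ).bondCurrent 3 1 = j1 := by
  funext x
  simp [OscillatorChain.bondCurrent, Fin.sum_univ_three, pinnedChain_deriv_V, j1]

/-- the three forces [folklore] -/
theorem partialQ0_H (γ : ℝ) (x : PhaseSpace 3) :
    partialQ 0 ((P3 γ).hamiltonian 3) x = (x.1 0 + x.1 0 ^ 3) - ((x.1 1 - x.1 0) + (x.1 1 - x.1 0) ^ 3) := by
  rw [OscillatorChain.partialQ_hamiltonian_eq_dPotential _
    ((pinnedChain_contDiff_U 1 1 1 γ (n := 1)).differentiable one_ne_zero)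
    ((pinnedChain_contDiff_V 1 1 1 γ (n := 1)).differentiable one_ne_zero)]
  simp [OscillatorChain.dPotential, Fin.sum_univ_three, pinnedChain_deriv_U, pinnedChain_deriv_V]
  all_goals ring_nf

/-- `partialQ1_H` (explicit computation / helper for the third-order witness). [folklore] -/
theorem partialQ1_H (γ : ℝ) (x : PhaseSpace 3) :
    partialQ 1 ((P3 γ).hamiltonian 3) x =
      (x.1 1 + x.1 1 ^ 3) + ((x.1 1 - x.1 0) + (x.1 1 - x.1 0) ^ 3) - ((x.1 2 - x.1 1) + (x.1 2 - x.1 1) ^ 3) := by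
  rw [OscillatorChain.partialQ_hamiltonian_eq_dPotential _
    ((pinnedChain_contDiff_U 1 1 1 γ (n := 1)).differentiable one_ne_zero)
    ((pinnedChain_contDiff_V 1 1 1 γ (n := 1)).differentiable one_ne_zero)]
  simp [OscillatorChain.dPotential, Fin.sum_univ_three, pinnedChain_deriv_U, pinnedChain_deriv_V]
  all_goals ring_nf

/-- `partialQ2_H` (explicit computation / helper for the third-order witness). [folklore] -/
theorem partialQ2_H (γ : ℝ) (x : PhaseSpace 3) :
    partialQ 2 ((P3 γ).hamiltonian 3) x =
      (x.1 2 + x.1 2 ^ 3) + ((x.1 2 - x.1 1) + (x.1 2 - x.1 1) ^ 3) := by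
  rw [OscillatorChain.partialQ_hamiltonian_eq_dPotential _
    ((pinnedChain_contDiff_U 1 1 1 γ (n := 1)).differentiable one_ne_zero)
    ((pinnedChain_contDiff_V 1 1 1 γ (n := 1)).differentiable one_ne_zero)]
  simp [OscillatorChain.dPotential, Fin.sum_univ_three, pinnedChain_deriv_U, pinnedChain_deriv_V]

/-! level 1: partials of j1 and the closed form of A j1 -/

/-- `partialQ0_j1` (explicit computation / helper for the third-order witness). [folklore] -/
theorem partialQ0_j1 (x : PhaseSpace 3) : partialQ 0 j1 x = 0 := by
  unfold partialQ j1
  simp only [upd01, upd02]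
  simp (disch := fun_prop) only [deriv_fun_add, deriv_fun_sub, deriv_fun_mul,
    deriv_fun_pow, deriv.fun_neg, deriv_const, 
    
    
    Nat.cast_ofNat]
  all_goals ring_nf
/-- `partialQ1_j1` (explicit computation / helper for the third-order witness). [folklore] -/
theorem partialQ1_j1 (x : PhaseSpace 3) :
    partialQ 1 j1 x = (x.2 1 + x.2 2) / 2 * (1 + 3 * (x.1 2 - x.1 1) ^ 2) := by
  unfold partialQ j1
  simp only [Function.update_self, upd12]
  simp (disch := fun_prop) only [deriv_fun_add, deriv_fun_mul,
    deriv_fun_pow, deriv.fun_neg, deriv_const, 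
    deriv_const_sub_self, 
    
    Nat.cast_ofNat]
  all_goals ring_nf
/-- `partialQ2_j1` (explicit computation / helper for the third-order witness). [folklore] -/
theorem partialQ2_j1 (x : PhaseSpace 3) :
    partialQ 2 j1 x = -((x.2 1 + x.2 2) / 2 * (1 + 3 * (x.1 2 - x.1 1) ^ 2)) := by
  unfold partialQ j1
  simp only [Function.update_self, upd21]
  simp (disch := fun_prop) only [deriv_fun_add, deriv_fun_sub, deriv_fun_mul,
    deriv_fun_pow, deriv.fun_neg, deriv_const, deriv_id'', 
    
    
    Nat.cast_ofNat]
  all_goals ring_nf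
/-- `partialP0_j1` (explicit computation / helper for the third-order witness). [folklore] -/
theorem partialP0_j1 (x : PhaseSpace 3) : partialP 0 j1 x = 0 := by
  unfold partialP j1
  simp only [upd01, upd02]
  simp (disch := fun_prop) only [deriv_fun_add, deriv_fun_sub, deriv_fun_mul,
    deriv_fun_pow, deriv.fun_neg, deriv_const, 
    
    
    Nat.cast_ofNat]
  all_goals ring_nf
/-- `partialP1_j1` (explicit computation / helper for the third-order witness). [folklore] -/
theorem partialP1_j1 (x : PhaseSpace 3) :
    partialP 1 j1 x = -(((x.1 2 - x.1 1) + (x.1 2 - x.1 1) ^ 3) / 2) := by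
  unfold partialP j1
  simp only [Function.update_self, upd12]
  simp (disch := fun_prop) only [deriv_fun_add, deriv_fun_sub, deriv_fun_mul,
    deriv_fun_pow, deriv.fun_neg, deriv_const, deriv_id'', deriv_div_const,
    
    
    Nat.cast_ofNat]
  all_goals ring_nf
/-- `partialP2_j1` (explicit computation / helper for the third-order witness). [folklore] -/
theorem partialP2_j1 (x : PhaseSpace 3) :
    partialP 2 j1 x = -(((x.1 2 - x.1 1) + (x.1 2 - x.1 1) ^ 3) / 2) := by
  unfold partialP j1
  simp only [Function.update_self, upd21]
  simp (disch := fun_prop) only [deriv_fun_add, deriv_fun_sub, deriv_fun_mul,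
    deriv_fun_pow, deriv.fun_neg, deriv_const, deriv_div_const,
    
    deriv_const_add_self, 
    Nat.cast_ofNat]
  all_goals ring_nf

/-- closed form of `A j_1` [folklore] -/
def Aj1 (x : PhaseSpace 3) : ℝ :=
  (x.2 1 ^ 2 - x.2 2 ^ 2) / 2 * (1 + 3 * (x.1 2 - x.1 1) ^ 2) +
    ((x.1 2 - x.1 1) + (x.1 2 - x.1 1) ^ 3) / 2 *
      ((x.1 1 + x.1 1 ^ 3) + (x.1 2 + x.1 2 ^ 3) + ((x.1 1 - x.1 0) + (x.1 1 - x.1 0) ^ 3))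

/-- `A_j1` (explicit computation / helper for the third-order witness). [folklore] -/
theorem A_j1 (γ : ℝ) : liouvilleOp (P3 γ) 3 j1 = Aj1 := by
  funext x
  unfold liouvilleOp
  rw [Fin.sum_univ_three, partialQ0_j1, partialQ1_j1, partialQ2_j1, partialP0_j1, partialP1_j1, partialP2_j1,
    partialQ0_H, partialQ1_H, partialQ2_H]
  unfold Aj1
  ring

/-! level 2: partials of Aj1 and the closed form of A² j1 -/
/-- `partialP0_Aj1` (explicit computation / helper for the third-order witness). [folklore] -/
theorem partialP0_Aj1 (x : PhaseSpace 3) : partialP 0 Aj1 x = 0 := by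
  unfold partialP Aj1
  simp only [upd01, upd02]
  simp (disch := fun_prop) only [deriv_fun_add, deriv_fun_sub, deriv_fun_mul,
    deriv_fun_pow, deriv_const, 
    
    
    Nat.cast_ofNat]
  all_goals ring_nf
/-- `partialP1_Aj1` (explicit computation / helper for the third-order witness). [folklore] -/
theorem partialP1_Aj1 (x : PhaseSpace 3) : partialP 1 Aj1 x = x.2 1 * (1 + 3 * (x.1 2 - x.1 1) ^ 2) := by
  unfold partialP Aj1
  simp only [Function.update_self, upd12]
  simp (disch := fun_prop) only [deriv_fun_add, deriv_fun_sub, deriv_fun_mul,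
    deriv_fun_pow, deriv_const, deriv_id'', deriv_div_const,
    
    
    Nat.cast_ofNat, mul_one]
  all_goals ring_nf
/-- `partialP2_Aj1` (explicit computation / helper for the third-order witness). [folklore] -/
theorem partialP2_Aj1 (x : PhaseSpace 3) : partialP 2 Aj1 x = -(x.2 2 * (1 + 3 * (x.1 2 - x.1 1) ^ 2)) := by
  unfold partialP Aj1
  simp only [Function.update_self, upd21]
  simp (disch := fun_prop) only [deriv_fun_add, deriv_fun_sub, deriv_fun_mul,
    deriv_fun_pow, deriv_const, deriv_id'', deriv_div_const,
    
    
    Nat.cast_ofNat, mul_one]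
  all_goals ring_nf
/-- `partialQ0_Aj1` (explicit computation / helper for the third-order witness). [folklore] -/
theorem partialQ0_Aj1 (x : PhaseSpace 3) :
    partialQ 0 Aj1 x = -(((x.1 2 - x.1 1) + (x.1 2 - x.1 1) ^ 3) / 2 * (1 + 3 * (x.1 1 - x.1 0) ^ 2)) := by
  unfold partialQ Aj1
  simp only [Function.update_self, upd01, upd02]
  simp (disch := fun_prop) only [deriv_fun_add, deriv_fun_sub, deriv_fun_mul,
    deriv_fun_pow, deriv_const, 
    deriv_const_sub_self, 
    
    Nat.cast_ofNat]
  all_goals ring_nf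
/-- `T1 = ∂_{q_1}(A j_1)` [folklore] -/
def T1 (x : PhaseSpace 3) : ℝ :=
  -((x.2 1 ^ 2 - x.2 2 ^ 2) / 2 * (6 * (x.1 2 - x.1 1))) -
    (1 + 3 * (x.1 2 - x.1 1) ^ 2) / 2 *
      ((x.1 1 + x.1 1 ^ 3) + (x.1 2 + x.1 2 ^ 3) + ((x.1 1 - x.1 0) + (x.1 1 - x.1 0) ^ 3)) +
    ((x.1 2 - x.1 1) + (x.1 2 - x.1 1) ^ 3) / 2 * ((1 + 3 * x.1 1 ^ 2) + (1 + 3 * (x.1 1 - x.1 0) ^ 2))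
/-- `T2 = ∂_{q_2}(A j_1)` [folklore] -/
def T2 (x : PhaseSpace 3) : ℝ :=
  (x.2 1 ^ 2 - x.2 2 ^ 2) / 2 * (6 * (x.1 2 - x.1 1)) +
    (1 + 3 * (x.1 2 - x.1 1) ^ 2) / 2 *
      ((x.1 1 + x.1 1 ^ 3) + (x.1 2 + x.1 2 ^ 3) + ((x.1 1 - x.1 0) + (x.1 1 - x.1 0) ^ 3)) +
    ((x.1 2 - x.1 1) + (x.1 2 - x.1 1) ^ 3) / 2 * (1 + 3 * x.1 2 ^ 2)
/-- `partialQ1_Aj1` (explicit computation / helper for the third-order witness). [folklore] -/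
theorem partialQ1_Aj1 (x : PhaseSpace 3) : partialQ 1 Aj1 x = T1 x := by
  unfold partialQ Aj1 T1
  simp only [Function.update_self, upd10, upd12]
  simp (disch := fun_prop) only [deriv_fun_add, deriv_fun_sub, deriv_fun_mul,
    deriv_fun_pow, deriv_const, deriv_id'', deriv_div_const,
    deriv_const_sub_self, 
    
    Nat.cast_ofNat, mul_one]
  all_goals ring_nf
/-- `partialQ2_Aj1` (explicit computation / helper for the third-order witness). [folklore] -/
theorem partialQ2_Aj1 (x : PhaseSpace 3) : partialQ 2 Aj1 x = T2 x := by
  unfold partialQ Aj1 T2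
  simp only [Function.update_self, upd20, upd21]
  simp (disch := fun_prop) only [deriv_fun_add, deriv_fun_sub, deriv_fun_mul,
    deriv_fun_pow, deriv_const, deriv_id'', deriv_div_const,
    
    
    Nat.cast_ofNat, mul_one]
  all_goals ring_nf

/-- closed form of `A² j_1` (as the Liouville combination of the level-2 partials) [folklore] -/
def A2j1 (x : PhaseSpace 3) : ℝ :=
  x.2 0 * (-(((x.1 2 - x.1 1) + (x.1 2 - x.1 1) ^ 3) / 2 * (1 + 3 * (x.1 1 - x.1 0) ^ 2))) +
  x.2 1 * T1 x + x.2 2 * T2 x -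
  ((x.1 1 + x.1 1 ^ 3) + ((x.1 1 - x.1 0) + (x.1 1 - x.1 0) ^ 3) - ((x.1 2 - x.1 1) + (x.1 2 - x.1 1) ^ 3)) *
    (x.2 1 * (1 + 3 * (x.1 2 - x.1 1) ^ 2)) -
  ((x.1 2 + x.1 2 ^ 3) + ((x.1 2 - x.1 1) + (x.1 2 - x.1 1) ^ 3)) * (-(x.2 2 * (1 + 3 * (x.1 2 - x.1 1) ^ 2)))

/-- `A_Aj1` (explicit computation / helper for the third-order witness). [folklore] -/
theorem A_Aj1 (γ : ℝ) : liouvilleOp (P3 γ) 3 Aj1 = A2j1 := by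
  funext x
  unfold liouvilleOp
  rw [Fin.sum_univ_three, partialQ0_Aj1, partialQ1_Aj1, partialQ2_Aj1, partialP0_Aj1, partialP1_Aj1, partialP2_Aj1,
    partialQ0_H, partialQ1_H, partialQ2_H]
  unfold A2j1
  ring


/-! ## Analysis I: a third-order sign lemma -/

open Set Filter Topology

/-- If `D₀' = D₁`, `D₁' = D₂`, `D₂' = D₃` on `(0, δ)`, all continuous on `[0, δ]` (resp. `D₃` right-continuous
at `0`), `D₀(0) = D₁(0) = D₂(0) = 0` and `D₃(0) > 0`, then `D₀ > 0` on some `(0, s₀]`. [folklore] -/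
theorem exists_pos_of_deriv3_pos {D0 D1 D2 D3 : ℝ → ℝ} {δ : ℝ} (hδ : 0 < δ)
    (hc0 : ContinuousOn D0 (Icc 0 δ)) (hc1 : ContinuousOn D1 (Icc 0 δ)) (hc2 : ContinuousOn D2 (Icc 0 δ))
    (hc3 : ContinuousWithinAt D3 (Ici 0) 0)
    (hd0 : ∀ s ∈ Ioo 0 δ, HasDerivAt D0 (D1 s) s) (hd1 : ∀ s ∈ Ioo 0 δ, HasDerivAt D1 (D2 s) s)
    (hd2 : ∀ s ∈ Ioo 0 δ, HasDerivAt D2 (D3 s) s)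
    (h0 : D0 0 = 0) (h1 : D1 0 = 0) (h2 : D2 0 = 0) (h3 : 0 < D3 0) :
    ∃ s₀, 0 < s₀ ∧ ∀ s ∈ Ioc 0 s₀, 0 < D0 s := by
  -- `D3 > 0` on a right neighbourhood of `0`
  have hev : ∀ᶠ s in 𝓝[Ici 0] 0, 0 < D3 s := hc3.eventually (lt_mem_nhds h3)
  rw [Filter.Eventually, mem_nhdsGE_iff_exists_Ico_subset] at hev
  obtain ⟨u, hu, hsub⟩ := hev
  have hu0 : 0 < u := hu
  set s₀ : ℝ := min (u / 2) (δ / 2) with hs₀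
  have hs₀pos : 0 < s₀ := lt_min (by linarith) (by linarith)
  have hs₀u : s₀ < u := (min_le_left _ _).trans_lt (by linarith)
  have hs₀δ : s₀ < δ := (min_le_right _ _).trans_lt (by linarith)
  have hpos3 : ∀ s ∈ Icc 0 s₀, 0 < D3 s := fun s hs => hsub ⟨hs.1, hs.2.trans_lt hs₀u⟩
  have hIcc : Icc 0 s₀ ⊆ Icc 0 δ := Icc_subset_Icc le_rfl hs₀δ.le
  have hIoo : ∀ s ∈ Ioo 0 s₀, s ∈ Ioo 0 δ := fun s hs => ⟨hs.1, hs.2.trans hs₀δ⟩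
  -- `D2` strictly increasing, hence positive
  have hm2 : StrictMonoOn D2 (Icc 0 s₀) := by
    refine strictMonoOn_of_deriv_pos (convex_Icc 0 s₀) (hc2.mono hIcc) fun s hs => ?_
    rw [interior_Icc] at hs
    rw [(hd2 s (hIoo s hs)).deriv]
    exact hpos3 s (Ioo_subset_Icc_self hs)
  have hpos2 : ∀ s ∈ Ioc 0 s₀, 0 < D2 s := fun s hs => by
    have := hm2 ⟨le_rfl, hs₀pos.le⟩ ⟨hs.1.le, hs.2⟩ hs.1
    rwa [h2] at this
  have hm1 : StrictMonoOn D1 (Icc 0 s₀) := by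
    refine strictMonoOn_of_deriv_pos (convex_Icc 0 s₀) (hc1.mono hIcc) fun s hs => ?_
    rw [interior_Icc] at hs
    rw [(hd1 s (hIoo s hs)).deriv]
    exact hpos2 s ⟨hs.1, hs.2.le⟩
  have hpos1 : ∀ s ∈ Ioc 0 s₀, 0 < D1 s := fun s hs => by
    have := hm1 ⟨le_rfl, hs₀pos.le⟩ ⟨hs.1.le, hs.2⟩ hs.1
    rwa [h1] at this
  have hm0 : StrictMonoOn D0 (Icc 0 s₀) := by
    refine strictMonoOn_of_deriv_pos (convex_Icc 0 s₀) (hc0.mono hIcc) fun s hs => ?_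
    rw [interior_Icc] at hs
    rw [(hd0 s (hIoo s hs)).deriv]
    exact hpos1 s ⟨hs.1, hs.2.le⟩
  refine ⟨s₀, hs₀pos, fun s hs => ?_⟩
  have := hm0 ⟨le_rfl, hs₀pos.le⟩ ⟨hs.1.le, hs.2⟩ hs.1
  rwa [h0] at this

/-- Signed version: `D₃(0) ≠ 0` ⇒ `D₀ ≠ 0` on some `(0, s₀]`. [folklore] -/
theorem exists_ne_zero_of_deriv3_ne_zero {D0 D1 D2 D3 : ℝ → ℝ} {δ : ℝ} (hδ : 0 < δ)
    (hc0 : ContinuousOn D0 (Icc 0 δ)) (hc1 : ContinuousOn D1 (Icc 0 δ)) (hc2 : ContinuousOn D2 (Icc 0 δ))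
    (hc3 : ContinuousWithinAt D3 (Ici 0) 0)
    (hd0 : ∀ s ∈ Ioo 0 δ, HasDerivAt D0 (D1 s) s) (hd1 : ∀ s ∈ Ioo 0 δ, HasDerivAt D1 (D2 s) s)
    (hd2 : ∀ s ∈ Ioo 0 δ, HasDerivAt D2 (D3 s) s)
    (h0 : D0 0 = 0) (h1 : D1 0 = 0) (h2 : D2 0 = 0) (h3 : D3 0 ≠ 0) :
    ∃ s₀, 0 < s₀ ∧ ∀ s ∈ Ioc 0 s₀, D0 s ≠ 0 := by
  rcases lt_or_gt_of_ne h3 with hneg | hpos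
  · obtain ⟨s₀, hs₀, H⟩ := exists_pos_of_deriv3_pos (D0 := fun s => -D0 s) (D1 := fun s => -D1 s)
      (D2 := fun s => -D2 s) (D3 := fun s => -D3 s) hδ hc0.neg hc1.neg hc2.neg hc3.neg
      (fun s hs => (hd0 s hs).neg) (fun s hs => (hd1 s hs).neg) (fun s hs => (hd2 s hs).neg)
      (by simp [h0]) (by simp [h1]) (by simp [h2]) (by simpa using hneg)
    exact ⟨s₀, hs₀, fun s hs => by have := H s hs; linarith⟩
  · obtain ⟨s₀, hs₀, H⟩ := exists_pos_of_deriv3_pos hδ hc0 hc1 hc2 hc3 hd0 hd1 hd2 h0 h1 h2 hpos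
    exact ⟨s₀, hs₀, fun s hs => (H s hs).ne'⟩

end Summit.AtomisticToContinuum.FouriersLaw.Theorems.TapLeakBound.Negative.LiouvilleAlgebraN3

end
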